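import Summits.QuantumAdvantage.QuantumAdvantage.Theorems.DigitRung.Negative.Reduction

/-!
# `DigitRung` (stmt-QuantumAdvantage-2423) — Walsh form, unstructured sets, and independence of the middle band (negative-side support)

Continuation of `Negative/Reduction.lean` (landed from `Cruxes/DigitRung/Disproof.lean` §5–§7).

* `concl_iff_total_and_walsh` — the rung ⇔ "dyadic mean → 2" ∧ "weight-one digital Walsh
  correlations `o(#𝒟_n)` uniformly in the position": a disproof is exactly a persistent weight-one
  Walsh bias of `#Cl₃`.
* `exists_subset_large_dev` — `#Cl₃ = 3^{r₃} ≠ 2` pointwise, so for unstructured test sets the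
  conclusion fails maximally (`≥ #𝒟_n/2`): any proof must use the digit structure.
* `gcd_six_mul_two_pow_ne_one` — the tree's Taniguchi–Thorne progression fact needs `gcd(6a, m) = 1`,
  never true for `m = 2^{j+1}`: the low-digit end is not in the tree even as a named fact.
* `model_ends_hold_middle_fails` — a `{1,3}`-valued model statistic exactly balanced on every set not
  involving digit `j` (all classes mod `2ᵏ`, `k ≤ j`; all dyadic intervals of length `≥ 2^{j+1}`) with
  digit-`j` Walsh correlation `= #block`: the printed ends cannot be interpolated into the middle band.
-/

noncomputable section

namespace Summit.QuantumAdvantage.DigitRung.Negative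

open scoped Classical
open Filter Finset
open Literature.NumberTheory.QuadraticFields
open Summit.QuantumAdvantage.QuantumAdvantage.Theses.ArithStatLadder (DigitRung)

/-! ## Equivalent Walsh form; the conclusion fails for unstructured test sets -/

/-- The digital Walsh character of weight one, `w_j(d) = (−1)^{bit_j(d)}`. -/
def walshSign (j d : ℕ) : ℝ := if Nat.testBit d j then -1 else 1

/-- The weight-one Walsh correlation `C_t(n, j) = Σ_{d ∈ 𝒟_n} (t(−d) − 2)·(−1)^{bit_j d}`. -/
def walsh (t : ℤ → ℕ) (n j : ℕ) : ℝ :=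
  ∑ d ∈ block n, ((t (-(d:ℤ)) : ℝ) - 2) * walshSign j d

/-- The block mean deviation `Σ_{d ∈ 𝒟_n} (t(−d) − 2)`. -/
def total (t : ℤ → ℕ) (n : ℕ) : ℝ := ∑ d ∈ block n, ((t (-(d:ℤ)) : ℝ) - 2)

/-- The block deviation splits over the two digit halves. [folklore] -/
theorem total_eq_dev_add_dev (t : ℤ → ℕ) (n j : ℕ) :
    total t n = dev t n j false + dev t n j true := by
  unfold total dev half
  rw [← Finset.sum_filter_add_sum_filter_not (block n) (fun d => Nat.testBit d j = false)]
  congr 1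
  refine Finset.sum_congr (Finset.filter_congr fun d _ => ?_) fun _ _ => rfl
  cases Nat.testBit d j <;> simp

/-- The Walsh correlation is the difference of the two digit-half deviations. [folklore] -/
theorem walsh_eq_dev_sub_dev (t : ℤ → ℕ) (n j : ℕ) :
    walsh t n j = dev t n j false - dev t n j true := by
  unfold walsh dev half
  rw [← Finset.sum_filter_add_sum_filter_not (block n) (fun d => Nat.testBit d j = false)]
  rw [sub_eq_add_neg, ← Finset.sum_neg_distrib]
  congr 1
  · refine Finset.sum_congr rfl fun d hd => ?_
    have hb : Nat.testBit d j = false := (Finset.mem_filter.mp hd).2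
    simp [walshSign, hb]
  · refine Finset.sum_congr (Finset.filter_congr fun d _ => ?_) fun d hd => ?_
    · cases Nat.testBit d j <;> simp
    · have hb : Nat.testBit d j = true := (Finset.mem_filter.mp hd).2
      simp [walshSign, hb]

/-- **Walsh form of the rung.** For any statistic, the digit-half conclusion is equivalent to
"block mean deviation `o(#𝒟_n)`" (the top digit, `Reduction.lean`) together with "weight-one digital Walsh
correlations `o(#𝒟_n)` uniformly in the position" — the `|S| = 1` case of the AC⁰ rung's
Fourier–Walsh programme (route item AcZeroRung; Green 2012 Prop. 1 is the Möbius analogue).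
A disproof of DigitRung is therefore exactly a persistent weight-one Walsh bias of `#Cl₃`. [folklore] -/
theorem concl_iff_total_and_walsh (t : ℤ → ℕ) :
    Concl t ↔
      (∀ ε : ℝ, 0 < ε → ∀ᶠ n : ℕ in atTop, |total t n| ≤ ε * ((block n).card : ℝ)) ∧
      (∀ ε : ℝ, 0 < ε → ∀ᶠ n : ℕ in atTop, ∀ j < n, |walsh t n j| ≤ ε * ((block n).card : ℝ)) := by
  constructor
  · intro h
    refine ⟨fun ε hε => ?_, fun ε hε => ?_⟩
    · filter_upwards [h ε hε, Filter.eventually_ge_atTop 1] with n hn hn1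
      have := hn (n - 1) (by omega) true
      rwa [dev, half_pred_true hn1] at this
    · filter_upwards [h (ε / 2) (half_pos hε)] with n hn j hj
      rw [walsh_eq_dev_sub_dev]
      have h0 := hn j hj false
      have h1 := hn j hj true
      calc |dev t n j false - dev t n j true| ≤ |dev t n j false| + |dev t n j true| := abs_sub _ _
        _ ≤ ε / 2 * ((block n).card : ℝ) + ε / 2 * ((block n).card : ℝ) := add_le_add h0 h1
        _ = ε * ((block n).card : ℝ) := by ring
  · rintro ⟨hT, hW⟩ ε hε
    filter_upwards [hT ε hε, hW ε hε] with n hn hw j hj b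
    have hw' := hw j hj
    rw [walsh_eq_dev_sub_dev] at hw'
    rw [total_eq_dev_add_dev t n j] at hn
    have hcard : (0 : ℝ) ≤ ε * ((block n).card : ℝ) := by positivity
    cases b
    · have : dev t n j false = (( dev t n j false + dev t n j true) +
          (dev t n j false - dev t n j true)) / 2 := by ring
      rw [this, abs_div, abs_two]
      calc |dev t n j false + dev t n j true + (dev t n j false - dev t n j true)| / 2
          ≤ (|dev t n j false + dev t n j true| + |dev t n j false - dev t n j true|) / 2 := by
            gcongr; exact abs_add_le _ _
        _ ≤ (ε * ((block n).card : ℝ) + ε * ((block n).card : ℝ)) / 2 := by gcongr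
        _ = ε * ((block n).card : ℝ) := by ring
    · have : dev t n j true = (( dev t n j false + dev t n j true) -
          (dev t n j false - dev t n j true)) / 2 := by ring
      rw [this, abs_div, abs_two]
      calc |dev t n j false + dev t n j true - (dev t n j false - dev t n j true)| / 2
          ≤ (|dev t n j false + dev t n j true| + |dev t n j false - dev t n j true|) / 2 := by
            gcongr; exact abs_sub _ _
        _ ≤ (ε * ((block n).card : ℝ) + ε * ((block n).card : ℝ)) / 2 := by gcongr
        _ = ε * ((block n).card : ℝ) := by ring

/-- `#Cl₃(D)` is a power of `3`, hence never `2`: every term of the centred sums has modulus `≥ 1`.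
[folklore] -/
theorem one_le_abs_canonical_sub_two (D : ℤ) :
    (1 : ℝ) ≤ |((quadFieldThreeTorsion D : ℝ)) - 2| := by
  obtain ⟨r, hr⟩ := exists_quadFieldThreeTorsion_eq_pow D
  rw [hr]
  rcases r with _ | r
  · norm_num
  · have h3 : (3 : ℝ) ≤ (3 : ℝ) ^ (r + 1) := by
      calc (3 : ℝ) = 3 ^ 1 := by norm_num
        _ ≤ 3 ^ (r + 1) := pow_le_pow_right₀ (by norm_num) (by omega)
    push_cast
    rw [abs_of_nonneg (by linarith)]
    linarith

/-- **Structure of the test set is essential.** For unstructured test sets `A ⊆ 𝒟_n` the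
conclusion of the rung fails as badly as possible: for every `n` some `A` (namely `{t < 2}` or
`{t > 2}`, whichever carries more absolute deviation) has `|Σ_{A} (#Cl₃(−d) − 2)| ≥ #𝒟_n / 2`,
because `#Cl₃ = 3^{r₃} ≠ 2` pointwise. So no argument that is insensitive to the shape of
`{bit_j = b}` (e.g. one using only `#half ≈ #𝒟_n/2`) can prove DigitRung, and the ladder can never
reach arbitrary (P/poly-style) test sets by statistics alone — the correlation bounds must use the
digit structure (residue classes / intervals / Bohr sets). [folklore] -/
theorem exists_subset_large_dev (n : ℕ) :
    ∃ A ⊆ block n, ((block n).card : ℝ) / 2 ≤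
      |∑ d ∈ A, ((quadFieldThreeTorsion (-(d:ℤ)) : ℝ) - 2)| := by
  set f : ℕ → ℝ := fun d => ((quadFieldThreeTorsion (-(d:ℤ)) : ℝ) - 2) with hf
  set Aneg := (block n).filter fun d => f d < 0 with hAneg
  set Apos := (block n).filter fun d => ¬ f d < 0 with hApos
  have hsum : ((block n).card : ℝ) ≤ |∑ d ∈ Aneg, f d| + |∑ d ∈ Apos, f d| := by
    have h1 : ((block n).card : ℝ) ≤ ∑ d ∈ block n, |f d| := by
      have : ∑ _d ∈ block n, (1 : ℝ) = (block n).card := by simp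
      rw [← this]
      exact Finset.sum_le_sum fun d _ => one_le_abs_canonical_sub_two _
    have h2 : ∑ d ∈ block n, |f d| = ∑ d ∈ Aneg, |f d| + ∑ d ∈ Apos, |f d| :=
      (Finset.sum_filter_add_sum_filter_not (block n) (fun d => f d < 0) _).symm
    have h3 : ∑ d ∈ Aneg, |f d| = |∑ d ∈ Aneg, f d| := by
      have hle : ∑ d ∈ Aneg, f d ≤ 0 :=
        Finset.sum_nonpos fun d hd => le_of_lt (Finset.mem_filter.mp hd).2
      rw [abs_of_nonpos hle, ← Finset.sum_neg_distrib]
      exact Finset.sum_congr rfl fun d hd => abs_of_neg (Finset.mem_filter.mp hd).2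
    have h4 : ∑ d ∈ Apos, |f d| = |∑ d ∈ Apos, f d| := by
      have hge : ∀ d ∈ Apos, 0 ≤ f d := fun d hd => not_lt.mp (Finset.mem_filter.mp hd).2
      rw [abs_of_nonneg (Finset.sum_nonneg hge)]
      exact Finset.sum_congr rfl fun d hd => abs_of_nonneg (hge d hd)
    linarith
  by_cases h : ((block n).card : ℝ) / 2 ≤ |∑ d ∈ Aneg, f d|
  · exact ⟨Aneg, Finset.filter_subset _ _, h⟩
  · refine ⟨Apos, Finset.filter_subset _ _, ?_⟩
    push Not at h
    linarith

/-! ## State of the tools for the two ends (bookkeeping facts for whoever attacks the band) -/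

/-- The tree's arithmetic-progression fact `tt_threeTorsion_sum_progression`
(ThreeTorsionMean.lean: Taniguchi–Thorne, Duke Thm 6) is stated only for `gcd(6a, m) = 1`; for the
digit moduli `m = 2^{j+1}` this side condition NEVER holds (`6a` is even). So, contrary to a loose
reading of the grounder notes, the low-digit end `j ≤ (5/43 − δ)n` is not available in the tree even
as a named fact: it needs TT's general twisted theorem (Duke Thm 25) / the CJM "4 ∣ m" AP theorem,
plus the 2-adic mass computation of `NoTwoAdicBias.lean`. [folklore] -/
theorem gcd_six_mul_two_pow_ne_one (a : ℤ) (j : ℕ) : Int.gcd (6 * a) (2 ^ (j + 1) : ℕ) ≠ 1 := by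
  intro h
  have h6 : ((2 : ℕ) : ℤ) ∣ 6 * a := ⟨3 * a, by ring⟩
  have h2 : ((2 : ℕ) : ℤ) ∣ ((2 ^ (j + 1) : ℕ) : ℤ) := ⟨2 ^ j, by push_cast; ring⟩
  have h22 : 2 ∣ Int.gcd (6 * a) (2 ^ (j + 1) : ℕ) := Int.dvd_gcd h6 h2
  rw [h] at h22
  norm_num at h22

/-! ## The two printed ends do not imply the middle band: a `{1,3}`-valued model statistic -/

/-- Flip the binary digit `j`. -/
def flipBit (j d : ℕ) : ℕ := d ^^^ 2 ^ j

/-- Flipping a digit twice is the identity. [folklore] -/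
theorem flipBit_flipBit (j d : ℕ) : flipBit j (flipBit j d) = d := by
  simp [flipBit]

/-- Digits of `flipBit j d`: digit `j` flipped, the others unchanged. [folklore] -/
theorem testBit_flipBit (j d i : ℕ) :
    (flipBit j d).testBit i = (d.testBit i ^^ decide (j = i)) := by
  simp [flipBit, Nat.testBit_xor, Nat.testBit_two_pow]

/-- Flipping digit `j` reverses the sign `(−1)^{bit_j}`. [folklore] -/
theorem walshSign_flipBit (j d : ℕ) : walshSign j (flipBit j d) = -walshSign j d := by
  unfold walshSign
  rw [testBit_flipBit]
  cases d.testBit j <;> simp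

/-- Flipping digit `j` does not change the residue mod `2^j` (the "low end" data)… -/
theorem flipBit_mod_two_pow (j d : ℕ) : flipBit j d % 2 ^ j = d % 2 ^ j := by
  apply Nat.eq_of_testBit_eq
  intro i
  rw [Nat.testBit_mod_two_pow, Nat.testBit_mod_two_pow, testBit_flipBit]
  by_cases hi : i < j
  · have : decide (j = i) = false := decide_eq_false (by omega)
    rw [this, Bool.xor_false]
  · simp [hi]

/-- … nor the quotient by `2^{j+1}` (the "high end" data: which dyadic interval of length
`2^{j+1}` contains `d`). -/
theorem flipBit_div_two_pow (j d : ℕ) : flipBit j d / 2 ^ (j + 1) = d / 2 ^ (j + 1) := by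
  apply Nat.eq_of_testBit_eq
  intro i
  rw [Nat.testBit_div_two_pow, Nat.testBit_div_two_pow, testBit_flipBit]
  have : decide (j = i + (j + 1)) = false := decide_eq_false (by omega)
  rw [this, Bool.xor_false]

/-- Flipping a digit `j ≤ n − 2` keeps an `n`-bit number `n`-bit. -/
theorem flipBit_mem_Ico {n j d : ℕ} (hj : j + 2 ≤ n) (hd : d ∈ Finset.Ico (2 ^ (n - 1)) (2 ^ n)) :
    flipBit j d ∈ Finset.Ico (2 ^ (n - 1)) (2 ^ n) := by
  rw [Finset.mem_Ico] at hd ⊢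
  obtain ⟨hlo, hhi⟩ := hd
  have htop : d.testBit (n - 1) = true := by
    by_contra hbit
    rw [Bool.not_eq_true] at hbit
    have : d < 2 ^ (n - 1) := by
      apply Nat.lt_pow_two_of_testBit
      intro i hi
      rcases Nat.lt_or_ge i n with hin | hin
      · have : i = n - 1 := by omega
        subst this
        exact hbit
      · exact Nat.testBit_lt_two_pow (hhi.trans_le (Nat.pow_le_pow_right two_pos hin))
    omega
  constructor
  · apply Nat.ge_two_pow_of_testBit
    rw [testBit_flipBit, htop, show decide (j = n - 1) = false from decide_eq_false (by omega)]
    rfl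
  · apply Nat.lt_pow_two_of_testBit
    intro i hi
    rw [testBit_flipBit, Nat.testBit_lt_two_pow (hhi.trans_le (Nat.pow_le_pow_right two_pos hi)),
      show decide (j = i) = false from decide_eq_false (by omega)]
    rfl

/-- Sums of `(−1)^{bit_j}` over sets stable under flipping digit `j` vanish. [folklore] -/
theorem sum_walshSign_eq_zero {j : ℕ} {S : Finset ℕ} (hS : ∀ d ∈ S, flipBit j d ∈ S) :
    ∑ d ∈ S, walshSign j d = 0 := by
  have h : ∑ d ∈ S, walshSign j d = ∑ d ∈ S, walshSign j (flipBit j d) :=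
    Finset.sum_nbij' (flipBit j) (flipBit j) hS hS (fun d _ => flipBit_flipBit j d)
      (fun d _ => flipBit_flipBit j d) (fun d _ => by rw [flipBit_flipBit])
  simp only [walshSign_flipBit, Finset.sum_neg_distrib] at h
  linarith

/-- **The printed ends do not imply the middle.** For every block length `n` and every position
`j ≤ n − 2` there is a `{1, 3}`-valued statistic `t'` on the `n`-bit integers (so it "looks like"
`3^{r₃}`) whose centred sums vanish EXACTLY on every set defined without digit `j` — in particular
on every residue class mod `2ᵏ`, `k ≤ j` (the shape of the Taniguchi–Thorne AP input) and on every
dyadic interval of length `≥ 2^{j+1}` (the shape of the BST/BTT interval input) and on all their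
Boolean combinations — while its digit-`j` Walsh correlation is maximal, `= 2^{n−1} = #block`.
Hence no argument can derive the digit-`j` rung from equidistribution data that does not itself
involve digit `j`: the middle band needs a genuinely new input (cancellation in
`Σ_F e(r·Disc F / 2^{j+1})`), it is not an interpolation between the two ends. The same model with
`w_i w_j` in place of `w_j` separates the AC⁰ rung's `|S| = 2` level from DigitRung. [folklore] -/
theorem model_ends_hold_middle_fails (n j : ℕ) (hj : j + 2 ≤ n) :
    (∀ d : ℕ, (2 + walshSign j d = 1) ∨ (2 + walshSign j d = 3)) ∧
      (∀ P : ℕ → ℕ → Prop,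
        ∑ d ∈ (Finset.Ico (2 ^ (n - 1)) (2 ^ n)).filter (fun d => P (d % 2 ^ j) (d / 2 ^ (j + 1))),
          ((2 + walshSign j d) - 2) = 0) ∧
      ∑ d ∈ Finset.Ico (2 ^ (n - 1)) (2 ^ n), ((2 + walshSign j d) - 2) * walshSign j d
        = (2 : ℝ) ^ (n - 1) := by
  refine ⟨fun d => ?_, fun P => ?_, ?_⟩
  · unfold walshSign
    cases d.testBit j <;> norm_num
  · simp only [add_sub_cancel_left]
    apply sum_walshSign_eq_zero
    intro d hd
    rw [Finset.mem_filter] at hd ⊢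
    exact ⟨flipBit_mem_Ico hj hd.1, by rw [flipBit_mod_two_pow, flipBit_div_two_pow]; exact hd.2⟩
  · have hsq : ∀ d : ℕ, ((2 + walshSign j d) - 2) * walshSign j d = 1 := by
      intro d
      unfold walshSign
      cases d.testBit j <;> norm_num
    simp only [hsq, Finset.sum_const, Nat.card_Ico, nsmul_eq_mul, mul_one]
    have hn : 1 ≤ n := by omega
    have : 2 ^ n - 2 ^ (n - 1) = 2 ^ (n - 1) := by
      have h2 : 2 ^ n = 2 * 2 ^ (n - 1) := by
        rw [← pow_succ']; congr 1; omega
      omega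
    rw [this]
    push_cast
    ring

end Summit.QuantumAdvantage.DigitRung.Negative

end
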